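import Mathlib
import HarnessLib
import Literature.MathematicalPhysics.QuantumLattice.FinDimSpectrumProofs
import Literature.MathematicalPhysics.QuantumLattice.FinDimSpectrumSpectralGapProofs
import Literature.MathematicalPhysics.QuantumLattice.GroundStateSourceBounds

/-!
# Crux `CwChiralConstruction` (stmt-HubbardSuperconductivity-1740), line `susceptibility-rise-budget`:
# stub `stub_secondOrderEnergyBounds` — lemmas, and the registered sub-goal `stub_cwReducedResolvent`

Support file (`--supports stmt-HubbardSuperconductivity-1740`) for the stub `stub_secondOrderEnergyBounds`
(file `ChiralWindowCwChiralConstructionSecondOrderEnergyBounds.lean`, which imports this one). Pure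
finite-dimensional linear algebra for a Hermitian `K : Matrix n n ℂ` (namespace `CwSecondOrder`): the
algebra and positivity of Mathlib's explicit functional calculus `hK.cfc f = U diag(f ∘ λ) U⋆`
(`Matrix.IsHermitian.cfc`), its action on the eigenvector basis and the rank-one case; under
`K.HasSpectralGap g` a ground index `i₀` (all other eigenvalues `≥ E₀ + g`), the rank-one ground
projection `K.groundProj = |ψ⟩⟨ψ|` (`ψ = u_{i₀}`, so the tracial ground state is `⟨ψ, · ψ⟩`); the
REDUCED RESOLVENT `R = hK.cfc (x ↦ (x - E₀)⁻¹) = Σ_{λ ≠ E₀} (λ - E₀)⁻¹ P_λ` (`0⁻¹ = 0` kills the ground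
term): `R ≥ 0`, `Rψ = 0`, `1 - gR - |ψ⟩⟨ψ| ≥ 0`, `R² ≤ g⁻¹R`, `KR = E₀R + 1 - |ψ⟩⟨ψ|` (packaged as the
registered sub-goal `stub_cwReducedResolvent`); the partial inverse `S = Σ_{λ ≠ E₀} (λ - E₀ - 2β)⁻¹ P_λ`
(`S ≥ 0`, `Sψ = 0`); and quadratic-form bookkeeping (`Re⟨x + αy, M(x + αy)⟩`,
`E₀(A)‖x‖² ≤ Re⟨x, Ax⟩`, `Re⟨x, Bx⟩ ≥ -‖B‖‖x‖²`, operator norm = `L2Operator` norm).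
Folklore (Kato, *Perturbation theory for linear operators*, §I.5.3 and §II.2; Reed–Simon IV §XII.1);
no definitions, no named facts, everything is proved.
-/

set_option linter.dupNamespace false

namespace Summit.HubbardSuperconductivity.HubbardSuperconductivity.Theorems

open Literature.MathematicalPhysics.QuantumLattice Matrix
open scoped Matrix.Norms.L2Operator ComplexOrder

namespace CwSecondOrder

variable {n : Type*} [Fintype n] [DecidableEq n] {K : Matrix n n ℂ} (hK : K.IsHermitian)

/-- `hK.cfc f = U diag(f ∘ λ) U⋆` unfolded. [folklore] -/
theorem cfc_eq_mul (f : ℝ → ℝ) :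
    hK.cfc f = (hK.eigenvectorUnitary : Matrix n n ℂ) *
      diagonal (fun i => ((f (hK.eigenvalues i) : ℝ) : ℂ)) *
        star (hK.eigenvectorUnitary : Matrix n n ℂ) := by
  rw [Matrix.IsHermitian.cfc, Unitary.conjStarAlgAut_apply]
  rfl

/-- Multiplicativity: `f(K) g(K) = (fg)(K)`. [folklore] -/
theorem cfc_mul (f g : ℝ → ℝ) : hK.cfc f * hK.cfc g = hK.cfc (f * g) := by
  unfold Matrix.IsHermitian.cfc
  rw [← map_mul, diagonal_mul_diagonal]
  congr 2
  funext i
  simp only [Function.comp_apply, Pi.mul_apply, RCLike.ofReal_mul]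

/-- Additivity: `f(K) + g(K) = (f + g)(K)`. [folklore] -/
theorem cfc_add (f g : ℝ → ℝ) : hK.cfc f + hK.cfc g = hK.cfc (f + g) := by
  unfold Matrix.IsHermitian.cfc
  rw [← map_add, diagonal_add]
  congr 2
  funext i
  simp only [Function.comp_apply, Pi.add_apply, RCLike.ofReal_add]

/-- `f(K) - g(K) = (f - g)(K)`. [folklore] -/
theorem cfc_sub (f g : ℝ → ℝ) : hK.cfc f - hK.cfc g = hK.cfc (f - g) := by
  unfold Matrix.IsHermitian.cfc
  rw [← map_sub, diagonal_sub]
  congr 2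
  funext i
  simp only [Function.comp_apply, Pi.sub_apply, RCLike.ofReal_sub]

/-- Real multiples: `a • f(K) = (a • f)(K)`. [folklore] -/
theorem cfc_smul (a : ℝ) (f : ℝ → ℝ) : (a : ℂ) • hK.cfc f = hK.cfc (a • f) := by
  unfold Matrix.IsHermitian.cfc
  rw [← map_smul, ← diagonal_smul]
  congr 2
  funext i
  simp only [Function.comp_apply, Pi.smul_apply, smul_eq_mul, RCLike.ofReal_mul]
  rfl

/-- `1(K) = 1`. [folklore] -/
theorem cfc_one : hK.cfc (fun _ => (1 : ℝ)) = 1 := by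
  unfold Matrix.IsHermitian.cfc
  have : (RCLike.ofReal ∘ (fun _ : ℝ => (1 : ℝ)) ∘ hK.eigenvalues : n → ℂ) = fun _ => 1 := by
    funext i; simp
  rw [this, diagonal_one, map_one]

/-- `id(K) = K` (the spectral theorem). [folklore] -/
theorem cfc_id : hK.cfc (fun x => x) = K := by
  conv_rhs => rw [hK.spectral_theorem]
  rfl

/-- `f(K)` only depends on the values of `f` on the eigenvalues. [folklore] -/
theorem cfc_congr {f g : ℝ → ℝ} (h : ∀ i, f (hK.eigenvalues i) = g (hK.eigenvalues i)) :
    hK.cfc f = hK.cfc g := by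
  unfold Matrix.IsHermitian.cfc
  congr 2
  funext i
  simp only [Function.comp_apply, h i]

/-- Positivity: `f(K) ≥ 0` as soon as `f ≥ 0` on the eigenvalues. [folklore] -/
theorem posSemidef_cfc {f : ℝ → ℝ} (h : ∀ i, 0 ≤ f (hK.eigenvalues i)) :
    (hK.cfc f).PosSemidef := by
  rw [cfc_eq_mul,
    (Unitary.isUnit_coe (U := hK.eigenvectorUnitary)).posSemidef_star_right_conjugate_iff,
    posSemidef_diagonal_iff]
  intro i
  exact_mod_cast h i

/-- `f(K) u_i = f(λ_i) u_i` on the eigenvector basis. [folklore] -/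
theorem cfc_mulVec_eigenvectorBasis (f : ℝ → ℝ) (i : n) :
    hK.cfc f *ᵥ ⇑(hK.eigenvectorBasis i) =
      ((f (hK.eigenvalues i) : ℝ) : ℂ) • ⇑(hK.eigenvectorBasis i) := by
  rw [cfc_eq_mul, ← mulVec_mulVec, ← mulVec_mulVec, hK.star_eigenvectorUnitary_mulVec,
    diagonal_mulVec_single, mul_one, ← hK.eigenvectorUnitary_mulVec, ← mulVec_smul]
  congr 1
  ext j
  by_cases hj : j = i
  · subst hj; simp
  · simp [hj]

/-- The rank-one case: if `f ∘ λ` is the indicator of one index `i₀` then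
`f(K) = |u_{i₀}⟩⟨u_{i₀}|`. [folklore] -/
theorem cfc_eq_vecMulVec {f : ℝ → ℝ} {i₀ : n}
    (hf : ∀ i, f (hK.eigenvalues i) = if i = i₀ then 1 else 0) :
    hK.cfc f = vecMulVec ⇑(hK.eigenvectorBasis i₀) (star ⇑(hK.eigenvectorBasis i₀)) := by
  ext a b
  rw [cfc_eq_mul, mul_apply, vecMulVec_apply]
  simp only [mul_diagonal, hf, apply_ite ((↑) : ℝ → ℂ), Complex.ofReal_one, Complex.ofReal_zero,
    mul_ite, mul_one, mul_zero, ite_mul, zero_mul, Finset.sum_ite_eq', Finset.mem_univ, if_true]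
  simp [Matrix.star_apply, IsHermitian.eigenvectorUnitary_apply]

/-- Orthonormality of the eigenvector basis in `dotProduct` form. [folklore] -/
theorem star_eigenvectorBasis_dotProduct (i j : n) :
    star ⇑(hK.eigenvectorBasis i) ⬝ᵥ ⇑(hK.eigenvectorBasis j) = if i = j then 1 else 0 := by
  rw [dotProduct_comm, ← EuclideanSpace.inner_eq_star_dotProduct]
  exact orthonormal_iff_ite.mp hK.eigenvectorBasis.orthonormal i j

/-- Under `K.HasSpectralGap g` there is a unique ground index `i₀`: `λ i₀ = E₀` and every other
eigenvalue is `≥ E₀ + g` (`IsHermitian.hasSpectralGap_iff_card_filter`). [folklore] -/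
theorem exists_ground_index {g : ℝ} (hgap : K.HasSpectralGap g) :
    ∃ i₀ : n, hK.eigenvalues i₀ = K.groundEnergy ∧
      ∀ i, i ≠ i₀ → K.groundEnergy + g ≤ hK.eigenvalues i := by
  obtain ⟨-, hcard, hsub⟩ := (hK.hasSpectralGap_iff_card_filter g).1 hgap
  obtain ⟨i₀, hi₀⟩ := Finset.card_eq_one.1 hcard
  have hmem : ∀ i, hK.eigenvalues i = K.groundEnergy ↔ i = i₀ := fun i => by
    have := Finset.ext_iff.1 hi₀ i
    simpa using this
  refine ⟨i₀, (hmem i₀).2 rfl, fun i hi => ?_⟩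
  have hne : hK.eigenvalues i ≠ K.groundEnergy := fun h => hi ((hmem i).1 h)
  rcases hsub ⟨i, rfl⟩ with h | h
  · exact absurd h hne
  · exact h

/-- **Rank-one ground projection.** Under the gap, `K.groundProj = |ψ⟩⟨ψ|` for the ground
eigenvector `ψ = u_{i₀}` (the ground space is the line through `ψ`, `P₀` is Hermitian, fixes the
ground space and maps into it). [folklore] -/
theorem groundProj_eq_vecMulVec {g : ℝ} (hgap : K.HasSpectralGap g) {i₀ : n}
    (hi₀ : hK.eigenvalues i₀ = K.groundEnergy) :
    K.groundProj = vecMulVec ⇑(hK.eigenvectorBasis i₀) (star ⇑(hK.eigenvectorBasis i₀)) := by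
  set ψ : n → ℂ := ⇑(hK.eigenvectorBasis i₀) with hψ
  have hψ1 : star ψ ⬝ᵥ ψ = 1 := by
    rw [hψ, star_eigenvectorBasis_dotProduct, if_pos rfl]
  have hψmem : ψ ∈ K.groundSpace := by
    rw [mem_groundSpace_iff, hψ, hK.mulVec_eigenvectorBasis, hi₀,
      RCLike.real_smul_eq_coe_smul (K := ℂ)]
    rfl
  have hψ0 : ψ ≠ 0 := fun h => by
    rw [h, dotProduct_zero] at hψ1
    exact zero_ne_one hψ1
  have h1 : Module.finrank ℂ K.groundSpace = 1 := hgap.hasUniqueGroundState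
  have hspan : ∀ w ∈ K.groundSpace, ∃ c : ℂ, c • ψ = w := by
    intro w hw
    have hne : (⟨ψ, hψmem⟩ : K.groundSpace) ≠ 0 := fun h => hψ0 (congrArg Subtype.val h)
    obtain ⟨c, hc⟩ :=
      (finrank_eq_one_iff_of_nonzero' (⟨ψ, hψmem⟩ : K.groundSpace) hne).1 h1 ⟨w, hw⟩
    exact ⟨c, congrArg Subtype.val hc⟩
  have hPψ : K.groundProj *ᵥ ψ = ψ := groundProj_mulVec_of_mem K hψmem
  rw [ext_iff_mulVec]
  intro w
  obtain ⟨c, hc⟩ := hspan _ (groundProj_mulVec_mem K w)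
  have hcval : c = star ψ ⬝ᵥ w := by
    have h2 : star ψ ⬝ᵥ (K.groundProj *ᵥ w) = c := by
      rw [← hc, dotProduct_smul, hψ1, smul_eq_mul, mul_one]
    rw [← h2, dotProduct_mulVec, ← conjTranspose_conjTranspose K.groundProj, ← star_mulVec,
      (groundProj_isHermitian K).eq, hPψ]
  rw [← hc, vecMulVec_mulVec, op_smul_eq_smul, hcval]

/-- If `K.groundProj = |ψ⟩⟨ψ|` with `ψ` a unit vector, the tracial ground state is the vector
state `ω(X) = ⟨ψ, Xψ⟩`. [folklore] -/
theorem groundStateFunctional_eq_of_groundProj {ψ : n → ℂ}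
    (hP : K.groundProj = vecMulVec ψ (star ψ)) (hψ1 : star ψ ⬝ᵥ ψ = 1) (X : Matrix n n ℂ) :
    K.groundStateFunctional X = star ψ ⬝ᵥ (X *ᵥ ψ) := by
  rw [groundStateFunctional_apply, hP, vecMulVec_mul, trace_vecMulVec, trace_vecMulVec,
    dotProduct_comm, hψ1, inv_one, one_mul, dotProduct_comm, dotProduct_mulVec]

omit [DecidableEq n] in
/-- `⟨y, Mx⟩ = conj ⟨x, My⟩` for Hermitian `M`. [folklore] -/
theorem star_dotProduct_mulVec_comm {M : Matrix n n ℂ} (hM : M.IsHermitian) (x y : n → ℂ) :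
    star y ⬝ᵥ (M *ᵥ x) = star (star x ⬝ᵥ (M *ᵥ y)) := by
  rw [star_dotProduct, star_mulVec, hM.eq, ← dotProduct_mulVec]

omit [DecidableEq n] in
/-- Expansion of a Hermitian quadratic form on `x + αy` (`α` complex):
`Re⟨x + αy, M(x + αy)⟩ = Re⟨x,Mx⟩ + 2 Re(α⟨x,My⟩) + |α|² Re⟨y,My⟩`. [folklore] -/
theorem re_quadratic_add_smul {M : Matrix n n ℂ} (hM : M.IsHermitian) (x y : n → ℂ) (α : ℂ) :
    (star (x + α • y) ⬝ᵥ (M *ᵥ (x + α • y))).re =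
      (star x ⬝ᵥ (M *ᵥ x)).re + 2 * (α * (star x ⬝ᵥ (M *ᵥ y))).re +
        Complex.normSq α * (star y ⬝ᵥ (M *ᵥ y)).re := by
  rw [mulVec_add, mulVec_smul, star_add, star_smul, add_dotProduct, dotProduct_add,
    dotProduct_add, smul_dotProduct, smul_dotProduct, dotProduct_smul, dotProduct_smul,
    star_dotProduct_mulVec_comm hM x y]
  simp only [smul_eq_mul, Complex.add_re, Complex.mul_re, Complex.mul_im, Complex.star_def,
    Complex.conj_re, Complex.conj_im, Complex.normSq_apply]
  ring

omit [DecidableEq n] in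
/-- Moving a matrix across the inner product: `⟨M x, y⟩ = ⟨x, Mᴴ y⟩`. [folklore] -/
theorem star_mulVec_dotProduct (M : Matrix n n ℂ) (x y : n → ℂ) :
    star (M *ᵥ x) ⬝ᵥ y = star x ⬝ᵥ (Mᴴ *ᵥ y) := by
  rw [star_mulVec, ← dotProduct_mulVec]

omit [DecidableEq n] in
/-- The real part of the quadratic form of a difference of matrices. [folklore] -/
theorem re_quadratic_sub (A B : Matrix n n ℂ) (x : n → ℂ) :
    (star x ⬝ᵥ ((A - B) *ᵥ x)).re = (star x ⬝ᵥ (A *ᵥ x)).re - (star x ⬝ᵥ (B *ᵥ x)).re := by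
  rw [sub_mulVec, dotProduct_sub, Complex.sub_re]

omit [DecidableEq n] in
/-- `Re⟨x, Bx⟩ ≤ c Re⟨x, Ax⟩` for a positive semidefinite `c • A - B` (`c` real). [folklore] -/
theorem re_le_of_posSemidef_smul_sub {A B : Matrix n n ℂ} {c : ℝ}
    (h : (((c : ℝ) : ℂ) • A - B).PosSemidef) (x : n → ℂ) :
    (star x ⬝ᵥ (B *ᵥ x)).re ≤ c * (star x ⬝ᵥ (A *ᵥ x)).re := by
  have h0 := h.re_dotProduct_nonneg x
  rw [RCLike.re_to_complex, sub_mulVec, smul_mulVec, dotProduct_sub, dotProduct_smul,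
    Complex.sub_re, smul_eq_mul, Complex.re_ofReal_mul] at h0
  linarith

/-- Variational principle for an unnormalised vector: `E₀(A) ‖x‖² ≤ Re⟨x, Ax⟩`. [folklore] -/
theorem groundEnergy_mul_re_le {A : Matrix n n ℂ} (hA : A.IsHermitian) (x : n → ℂ) :
    A.groundEnergy * (star x ⬝ᵥ x).re ≤ (star x ⬝ᵥ (A *ᵥ x)).re := by
  have h := (posSemidef_sub_groundEnergy hA).re_dotProduct_nonneg x
  rw [sub_mulVec, dotProduct_sub, Algebra.algebraMap_eq_smul_one, smul_mulVec, one_mulVec,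
    dotProduct_smul] at h
  rw [RCLike.re_to_complex, Complex.sub_re, Complex.real_smul, Complex.re_ofReal_mul] at h
  linarith

/-- `Re⟨x, Bx⟩ ≥ -‖B‖ ‖x‖²` for Hermitian `B` (its spectrum lies in the norm ball). [folklore] -/
theorem neg_norm_mul_re_le {B : Matrix n n ℂ} (hB : B.IsHermitian) [Nonempty n] (x : n → ℂ) :
    -(‖B‖ * (star x ⬝ᵥ x).re) ≤ (star x ⬝ᵥ (B *ᵥ x)).re := by
  have h1 := groundEnergy_mul_re_le hB x
  have h2 := neg_norm_le_groundEnergy hB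
  have h0 : 0 ≤ (star x ⬝ᵥ x).re := (Complex.nonneg_iff.mp (dotProduct_star_self_nonneg x)).1
  nlinarith

section Gap

variable {g : ℝ} {i₀ : n}

/-- Off the ground index the eigenvalues differ from the ground energy. [folklore] -/
theorem eigenvalues_ne_groundEnergy (hg : 0 < g)
    (hgap' : ∀ i, i ≠ i₀ → K.groundEnergy + g ≤ hK.eigenvalues i) {i : n} (hi : i ≠ i₀) :
    hK.eigenvalues i ≠ K.groundEnergy := fun h => by
  have := hgap' i hi
  rw [h] at this
  linarith

/-- The indicator of the ground eigenvalue is the indicator of the ground index. [folklore] -/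
theorem ite_eigenvalues_eq (hg : 0 < g) (hi₀ : hK.eigenvalues i₀ = K.groundEnergy)
    (hgap' : ∀ i, i ≠ i₀ → K.groundEnergy + g ≤ hK.eigenvalues i) (a b : ℝ) (i : n) :
    (if hK.eigenvalues i = K.groundEnergy then a else b) = if i = i₀ then a else b := by
  by_cases hi : i = i₀
  · subst hi; simp [hi₀]
  · rw [if_neg (eigenvalues_ne_groundEnergy hK hg hgap' hi), if_neg hi]

/-- The ground projection `|ψ⟩⟨ψ|` as a function of `K`. [folklore] -/
theorem vecMulVec_eq_cfc (hg : 0 < g) (hi₀ : hK.eigenvalues i₀ = K.groundEnergy)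
    (hgap' : ∀ i, i ≠ i₀ → K.groundEnergy + g ≤ hK.eigenvalues i) :
    vecMulVec ⇑(hK.eigenvectorBasis i₀) (star ⇑(hK.eigenvectorBasis i₀)) =
      hK.cfc (fun x => if x = K.groundEnergy then 1 else 0) :=
  (cfc_eq_vecMulVec hK (fun i => ite_eigenvalues_eq hK hg hi₀ hgap' 1 0 i)).symm

/-- The reduced resolvent `R = Σ_{λ ≠ E₀} (λ - E₀)⁻¹ P_λ` is positive semidefinite. [folklore] -/
theorem posSemidef_resolvent : (hK.cfc fun x => (x - K.groundEnergy)⁻¹).PosSemidef :=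
  posSemidef_cfc hK fun i => inv_nonneg.2 (sub_nonneg.2 (groundEnergy_le_eigenvalues hK i))

/-- `R ψ = 0` on the ground vector. [folklore] -/
theorem resolvent_mulVec_ground (hi₀ : hK.eigenvalues i₀ = K.groundEnergy) :
    (hK.cfc fun x => (x - K.groundEnergy)⁻¹) *ᵥ ⇑(hK.eigenvectorBasis i₀) = 0 := by
  rw [cfc_mulVec_eigenvectorBasis, hi₀, sub_self, _root_.inv_zero, Complex.ofReal_zero, zero_smul]

/-- `1 - g R - |ψ⟩⟨ψ| ≥ 0` (i.e. `R ≤ g⁻¹ (1 - P₀)`) under the gap. [folklore] -/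
theorem posSemidef_one_sub_resolvent (hg : 0 < g) (hi₀ : hK.eigenvalues i₀ = K.groundEnergy)
    (hgap' : ∀ i, i ≠ i₀ → K.groundEnergy + g ≤ hK.eigenvalues i) :
    (1 - ((g : ℝ) : ℂ) • hK.cfc (fun x => (x - K.groundEnergy)⁻¹) -
      vecMulVec ⇑(hK.eigenvectorBasis i₀) (star ⇑(hK.eigenvectorBasis i₀))).PosSemidef := by
  rw [vecMulVec_eq_cfc hK hg hi₀ hgap', ← cfc_one hK, cfc_smul, cfc_sub, cfc_sub]
  refine posSemidef_cfc hK fun i => ?_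
  simp only [Pi.sub_apply, Pi.smul_apply, smul_eq_mul]
  by_cases hi : i = i₀
  · subst hi
    rw [hi₀, sub_self, _root_.inv_zero, mul_zero, if_pos rfl]
    norm_num
  · have h1 := hgap' i hi
    rw [if_neg (eigenvalues_ne_groundEnergy hK hg hgap' hi)]
    have hd : 0 < hK.eigenvalues i - K.groundEnergy := by linarith
    rw [sub_zero, sub_nonneg, ← div_eq_mul_inv, div_le_one hd]
    linarith

/-- `R² ≤ g⁻¹ R` under the gap. [folklore] -/
theorem posSemidef_resolvent_sub_sq (hg : 0 < g) (hi₀ : hK.eigenvalues i₀ = K.groundEnergy)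
    (hgap' : ∀ i, i ≠ i₀ → K.groundEnergy + g ≤ hK.eigenvalues i) :
    (((g⁻¹ : ℝ) : ℂ) • hK.cfc (fun x => (x - K.groundEnergy)⁻¹) -
      hK.cfc (fun x => (x - K.groundEnergy)⁻¹) *
        hK.cfc (fun x => (x - K.groundEnergy)⁻¹)).PosSemidef := by
  rw [cfc_mul, cfc_smul, cfc_sub]
  refine posSemidef_cfc hK fun i => ?_
  simp only [Pi.sub_apply, Pi.smul_apply, Pi.mul_apply, smul_eq_mul]
  by_cases hi : i = i₀
  · subst hi
    rw [hi₀, sub_self, _root_.inv_zero]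
    norm_num
  · have h1 := hgap' i hi
    have hd : 0 < hK.eigenvalues i - K.groundEnergy := by linarith
    have hle : (hK.eigenvalues i - K.groundEnergy)⁻¹ ≤ g⁻¹ := inv_anti₀ hg (by linarith)
    have h0 : 0 ≤ (hK.eigenvalues i - K.groundEnergy)⁻¹ := inv_nonneg.2 hd.le
    nlinarith

/-- `K R = E₀ R + (1 - |ψ⟩⟨ψ|)`, i.e. `(K - E₀) R = 1 - P₀`. [folklore] -/
theorem hamiltonian_mul_resolvent (hg : 0 < g) (hi₀ : hK.eigenvalues i₀ = K.groundEnergy)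
    (hgap' : ∀ i, i ≠ i₀ → K.groundEnergy + g ≤ hK.eigenvalues i) :
    K * hK.cfc (fun x => (x - K.groundEnergy)⁻¹) =
      ((K.groundEnergy : ℝ) : ℂ) • hK.cfc (fun x => (x - K.groundEnergy)⁻¹) +
        (1 - vecMulVec ⇑(hK.eigenvectorBasis i₀) (star ⇑(hK.eigenvectorBasis i₀))) := by
  have h : hK.cfc (fun x => x) * hK.cfc (fun x => (x - K.groundEnergy)⁻¹) =
      ((K.groundEnergy : ℝ) : ℂ) • hK.cfc (fun x => (x - K.groundEnergy)⁻¹) +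
        (1 - vecMulVec ⇑(hK.eigenvectorBasis i₀) (star ⇑(hK.eigenvectorBasis i₀))) := by
    rw [vecMulVec_eq_cfc hK hg hi₀ hgap', ← cfc_one hK, cfc_sub, cfc_smul, cfc_add, cfc_mul]
    refine cfc_congr hK fun i => ?_
    simp only [Pi.mul_apply, Pi.add_apply, Pi.sub_apply, Pi.smul_apply, smul_eq_mul]
    by_cases hi : i = i₀
    · subst hi
      rw [hi₀, sub_self, _root_.inv_zero, if_pos rfl]
      ring
    · rw [if_neg (eigenvalues_ne_groundEnergy hK hg hgap' hi)]
      have hd : hK.eigenvalues i - K.groundEnergy ≠ 0 :=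
        sub_ne_zero.2 (eigenvalues_ne_groundEnergy hK hg hgap' hi)
      field_simp
      ring
  rwa [cfc_id hK] at h

/-- The partial inverse `S = Σ_{λ ≠ E₀} (λ - E₀ - 2β)⁻¹ P_λ` of the shifted operator is positive
semidefinite (in particular Hermitian) for `2β < g`. [folklore] -/
theorem posSemidef_partialInv (hg : 0 < g) (hi₀ : hK.eigenvalues i₀ = K.groundEnergy)
    (hgap' : ∀ i, i ≠ i₀ → K.groundEnergy + g ≤ hK.eigenvalues i) {β : ℝ} (hβg : 2 * β < g) :
    (hK.cfc fun x => if x = K.groundEnergy then 0 else (x - K.groundEnergy - 2 * β)⁻¹).PosSemidef := by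
  refine posSemidef_cfc hK fun i => ?_
  by_cases hi : i = i₀
  · subst hi
    rw [hi₀, if_pos rfl]
  · have h1 := hgap' i hi
    rw [if_neg (eigenvalues_ne_groundEnergy hK hg hgap' hi)]
    exact inv_nonneg.2 (by linarith)

/-- `S ψ = 0` for the partial inverse `S`. [folklore] -/
theorem partialInv_mulVec_ground (hi₀ : hK.eigenvalues i₀ = K.groundEnergy) (β : ℝ) :
    (hK.cfc fun x => if x = K.groundEnergy then 0 else (x - K.groundEnergy - 2 * β)⁻¹) *ᵥ
      ⇑(hK.eigenvectorBasis i₀) = 0 := by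
  rw [cfc_mulVec_eigenvectorBasis, hi₀, if_pos rfl, Complex.ofReal_zero, zero_smul]

end Gap

end CwSecondOrder

open CwSecondOrder in
/-- **Registered sub-goal `stub_cwReducedResolvent`** (helper of stub `stub_secondOrderEnergyBounds`): the
reduced-resolvent package of a Hermitian matrix with a unique gapped ground state — a unit ground vector
`ψ` with `K.groundProj = |ψ⟩⟨ψ|`, and `R ≥ 0` with `Rψ = 0`, `1 - gR - |ψ⟩⟨ψ| ≥ 0`, `R² ≤ g⁻¹R`,
`KR = E₀R + 1 - |ψ⟩⟨ψ|`. [folklore] -/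
theorem stub_cwReducedResolvent :
    ∀ {n : Type} [Fintype n] [DecidableEq n] (K : Matrix n n ℂ) (g : ℝ), K.IsHermitian → 0 < g → K.HasSpectralGap g → ∃ (ψ : n → ℂ) (R : Matrix n n ℂ), star ψ ⬝ᵥ ψ = 1 ∧ K *ᵥ ψ = (K.groundEnergy : ℂ) • ψ ∧ K.groundProj = Matrix.vecMulVec ψ (star ψ) ∧ R.PosSemidef ∧ R *ᵥ ψ = 0 ∧ (1 - (g : ℂ) • R - Matrix.vecMulVec ψ (star ψ)).PosSemidef ∧ (((g⁻¹ : ℝ) : ℂ) • R - R * R).PosSemidef ∧ K * R = (K.groundEnergy : ℂ) • R + (1 - Matrix.vecMulVec ψ (star ψ)) := by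
  intro n _ _ K g hK hg hgap
  obtain ⟨i₀, hi₀, hgap'⟩ := exists_ground_index hK hgap
  refine ⟨⇑(hK.eigenvectorBasis i₀), hK.cfc (fun x => (x - K.groundEnergy)⁻¹), ?_, ?_,
    groundProj_eq_vecMulVec hK hgap hi₀, posSemidef_resolvent hK, resolvent_mulVec_ground hK hi₀,
    posSemidef_one_sub_resolvent hK hg hi₀ hgap', posSemidef_resolvent_sub_sq hK hg hi₀ hgap',
    hamiltonian_mul_resolvent hK hg hi₀ hgap'⟩
  · rw [star_eigenvectorBasis_dotProduct, if_pos rfl]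
  · rw [hK.mulVec_eigenvectorBasis, hi₀, RCLike.real_smul_eq_coe_smul (K := ℂ)]
    rfl

end Summit.HubbardSuperconductivity.HubbardSuperconductivity.Theorems
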